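import Summits.Ventures.CertifiedManyBodySolver.Observables.PairLROTowerStationaryReading
import HarnessLib

/-!
# OP1-S, certificate form: a window certificate WITH neutral equation-of-motion rows, read in an arbitrary
# unit vector, and the summit-format leaf it gives

HONEST FRAMING: first certified bounds on pairing observables; not a superconductivity verdict; a ceiling
route, never presence. Crew hubbard-obs (D-0042), seat hubbard-obs-p1 (`prover-hubbard-obs-p1-g6-0`).
Zero compute; no definition; no named fact; no `sorry`.

The variational window-certificate theorem `re_orbitState_ge_of_window_variational_certificate_d4_TT'_ineq`
(Literature, OP1-E: SOS + affine-`D₄` defects + filling rows + one energy row, NO stationarity terms) read in the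
orbit state of an ARBITRARY unit torus vector `ζ`. Adding ONE equation-of-motion block
`E = H^{tt'}_{Λ'} Γ(incl) B − Γ(incl) B H^{tt'}_{Λ'}` (`B ∈ 𝔄_Λ`, `thicken Λ 1 ⊆ Λ'`; all neutral eom rows of a
certificate with their multipliers combine into one such `B`) to the identity is the same theorem applied to the
objective `X − E` (linearity), and on the torus `Γ_L E = [H_L, Γ_L Γ(incl) B]`
(`hubbardTorusTT'_commutator_fermionEmbed`):

* `commute_totalNumberOp_sum_smul_ladderWord` — a combination of charge-zero ladder words commutes with the
  particle number of the window (the hypothesis `[N̂, X] = 0` of the OP1-S node, discharged from the word list);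
* `re_orbitState_ge_of_window_stationary_certificate_d4_TT'_ineq` — the OP1-S window certificate read in `ω̄_ζ`:
  `c − Σ‖a_k‖ + Σ_σ μ_σ(Re⟨ζ,N_σζ⟩/L² − ν) + κ(u − Re⟨ζ,H_Lζ⟩/L²) + Re ω̄_ζ(H_L Γ_L Γ(incl)B − Γ_L Γ(incl)B H_L) ≤ Re ω̄_ζ(Γ_L X)`;
* **`M3ObsPairLROCeilingAt_of_onePoint_stationary_certificate_sq`** — an OP1-S certificate identity for the one-point
  objective `X = −Γ(incl) Φ₀` with a number-conserving eom block gives `M3ObsPairLROCeilingAt tp c` for every rational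
  `c ≥ (c₀ − Σ‖a_k‖ + (Σ_σ μ_σ)(7/16 − ν))²` — the OP1-E statement
  `M3ObsPairLROCeilingAt_of_onePoint_variational_certificate_sq` with eom rows switched on, NO extra hypothesis on the
  state side.

References: T. Koma, H. Tasaki, J. Stat. Phys. 76 (1994) 745, Theorem 5 [KomaTasaki1994]; X. Han,
arXiv:2006.06002, §2–3 [Han2020Bootstrap]; J. Wang et al., PRX 14 (2024) 031006, §III [WangEtAl2024];
W. Pusz, S. L. Woronowicz, Comm. Math. Phys. 58 (1978) 273, §1 [PuszWoronowicz1978].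
-/

noncomputable section

namespace Summit.Ventures.CertifiedManyBodySolver.Observables

open Matrix Complex Finset Literature.MathematicalPhysics.QuantumLattice Literature.Probability.LatticeModels
open Literature.MathematicalPhysics.QuantumLattice.HubbardWave0 ThermodynamicLimit Filter Topology
open Literature.MathematicalPhysics.QuantumManyBody.StateRelaxation
open Summit.Ventures.CertifiedManyBodySolver.Transport
open scoped ComplexOrder ComplexConjugate BigOperators

/-! ### §1  Neutral word combinations commute with the particle number -/

section Neutral

variable {Λw : Finset (Site 2)}

/-- **A combination of charge-zero ladder words commutes with the particle number of its window**
(`[N̂, w] = (ladderCharge w)·w`, `totalNumber_comm_ladderWord`). This discharges the hypothesis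
`Commute totalNumberOp X` of the OP1-S node from the certificate's word list. [cite: Han2020Bootstrap, §2] -/
theorem commute_totalNumberOp_sum_smul_ladderWord {κ : Type*} (s : Finset κ) (ρ : κ → ℂ)
    (w : κ → List (Orb (PolySite Λw) × Bool)) (hq : ∀ k ∈ s, ladderCharge (w k) = 0) :
    Commute (totalNumberOp : FermionOp Λw) (∑ k ∈ s, ρ k • ladderWord (w k)) := by
  refine Commute.sum_right _ _ _ fun k hk => Commute.smul_right ?_ _
  have h := totalNumber_comm_ladderWord (w k)
  rw [hq k hk, Int.cast_zero, zero_smul, sub_eq_zero] at h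
  rw [totalNumberOp_eq_totalNumber]
  exact h

end Neutral

/-! ### §2  The window certificate with an equation-of-motion block, read in an arbitrary unit vector -/

section Window

variable {L : ℕ} [NeZero L]

/-- **OP1-S window certificate ⇒ orbit-state inequality with the eom term, for EVERY unit torus vector.**
Data of `re_orbitState_ge_of_window_variational_certificate_d4_TT'_ineq` (objective `X ∈ 𝔄_{Λ'}`, filling rows,
energy row, SOS, affine-`D₄` defects over `S`, anti-Hermitian parts, residual words) PLUS one equation-of-motion block
`H^{tt'}_{Λ'} Γ(incl) B − Γ(incl) B H^{tt'}_{Λ'}`, `B ∈ 𝔄_Λ`, `thicken Λ 1 ⊆ Λ'`, `x ↦ x mod L` injective on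
`thicken Λ' 1`. Conclusion: `c − Σ‖a_k‖ + Σ_σ μ_σ(Re⟨ζ,N_σζ⟩/L² − ν) + κ(u − Re⟨ζ,H_Lζ⟩/L²)
+ Re ω̄_ζ(H_L Γ_L Γ(incl)B − Γ_L Γ(incl)B H_L) ≤ Re ω̄_ζ(Γ_L X)` (the eom term does not vanish on `ζ`; it is kept).
[cite: WangEtAl2024, §III] [cite: Han2020Bootstrap, §3] -/
theorem re_orbitState_ge_of_window_stationary_certificate_d4_TT'_ineq (t t' U : ℝ) (hL : 3 ≤ L)
    {Λ Λ' : Finset (Site 2)} (hΛ : Λ ⊆ Λ') (h8 : thicken Λ 1 ⊆ Λ')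
    (h0 : thicken ({0} : Finset (Site 2)) 1 ⊆ Λ') (hz : (0 : Site 2) ∈ Λ')
    (hInjT : Set.InjOn (Torus.proj (d := 2) L) ↑(thicken Λ' 1))
    (hInj' : Set.InjOn (Torus.proj (d := 2) L) ↑Λ')
    {S : Finset (DihedralGroup 4)} (h1 : (1 : DihedralGroup 4) ∈ S) (hmul : ∀ a ∈ S, ∀ b ∈ S, a * b ∈ S)
    {ζ : Fock (Orb (FermionTorus 2 L))} (hζ1 : star ζ ⬝ᵥ ζ = 1)
    (Xw : FermionOp Λ') (κ u : ℝ) (μ : Fin 2 → ℝ) (ν : ℝ)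
    {m : Type*} [Fintype m] [DecidableEq m] {Λm : Matrix m m ℂ} (hΛm : Λm.PosSemidef)
    (O : m → FermionOp Λ') (B : FermionOp Λ)
    {ι : Type*} (tt : Finset ι) (γ : ι → DihedralGroup 4) (hγS : ∀ l ∈ tt, γ l ∈ S) (wv : ι → Site 2)
    (hsh : ∀ l, d4ShiftSet (γ l) (wv l) Λ ⊆ Λ') (Y : ι → FermionOp Λ)
    {δ : Type*} (ah : Finset δ) (dc : δ → ℝ) (V : δ → FermionOp Λ')
    {κ'' : Type*} (w : Finset κ'') (a : κ'' → ℂ) (word : κ'' → List (Orb (PolySite Λ') × Bool)) {c : ℝ}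
    (hcert : Xw - (c : ℂ) • (1 : FermionOp Λ') -
        ∑ σ : Fin 2, ((μ σ : ℝ) : ℂ) • (nAt 0 hz σ - ((ν : ℝ) : ℂ) • (1 : FermionOp Λ')) -
        ((κ : ℝ) : ℂ) • (((u : ℝ) : ℂ) • (1 : FermionOp Λ') -
          fermionEmbed (PolySite.incl h0) ((hubbardTTPrimeFermionInteraction t t' U).meanEnergyObs 1)) =
      gramForm Λm O +
        ((hubbardTTPrimeFermionInteraction t t' U).localHamiltonian Λ' * fermionEmbed (PolySite.incl hΛ) B -
          fermionEmbed (PolySite.incl hΛ) B * (hubbardTTPrimeFermionInteraction t t' U).localHamiltonian Λ') +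
        ∑ l ∈ tt, (fermionEmbed (PolySite.incl (hsh l)) (fermionEmbed (PolySite.d4Emb (γ l) (wv l) Λ) (Y l)) -
            fermionEmbed (PolySite.incl hΛ) (Y l)) +
        (∑ m' ∈ ah, ((dc m' : ℝ) : ℂ) • ((V m')ᴴ - V m') + ∑ k ∈ w, a k • ladderWord (word k))) :
    c - ∑ k ∈ w, ‖a k‖ +
        ∑ σ : Fin 2, μ σ * ((star ζ ⬝ᵥ ((∑ y : FermionTorus 2 L, numberOp y σ) *ᵥ ζ)).re / (L : ℝ) ^ 2 - ν) +
        κ * (u - (star ζ ⬝ᵥ (hubbardTorusTT' L t t' U *ᵥ ζ)).re / (L : ℝ) ^ 2) +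
        (orbitState (spaceGroupUnitary S) ζ
          (hubbardTorusTT' L t t' U *
              fermionEmbed (PolySite.toTorusEmb L hInj') (fermionEmbed (PolySite.incl hΛ) B) -
            fermionEmbed (PolySite.toTorusEmb L hInj') (fermionEmbed (PolySite.incl hΛ) B) *
              hubbardTorusTT' L t t' U)).re ≤
      (orbitState (spaceGroupUnitary S) ζ (fermionEmbed (PolySite.toTorusEmb L hInj') Xw)).re := by
  set E : FermionOp Λ' := (hubbardTTPrimeFermionInteraction t t' U).localHamiltonian Λ' *
      fermionEmbed (PolySite.incl hΛ) B -
    fermionEmbed (PolySite.incl hΛ) B * (hubbardTTPrimeFermionInteraction t t' U).localHamiltonian Λ' with hE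
  -- the same identity for the objective `X − E`, without the eom block
  have hcert' : (Xw - E) - (c : ℂ) • (1 : FermionOp Λ') -
        ∑ σ : Fin 2, ((μ σ : ℝ) : ℂ) • (nAt 0 hz σ - ((ν : ℝ) : ℂ) • (1 : FermionOp Λ')) -
        ((κ : ℝ) : ℂ) • (((u : ℝ) : ℂ) • (1 : FermionOp Λ') -
          fermionEmbed (PolySite.incl h0) ((hubbardTTPrimeFermionInteraction t t' U).meanEnergyObs 1)) =
      gramForm Λm O +
        ∑ l ∈ tt, (fermionEmbed (PolySite.incl (hsh l)) (fermionEmbed (PolySite.d4Emb (γ l) (wv l) Λ) (Y l)) -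
            fermionEmbed (PolySite.incl hΛ) (Y l)) +
        (∑ m' ∈ ah, ((dc m' : ℝ) : ℂ) • ((V m')ᴴ - V m') + ∑ k ∈ w, a k • ladderWord (word k)) := by
    have e1 : (Xw - E) - (c : ℂ) • (1 : FermionOp Λ') -
        ∑ σ : Fin 2, ((μ σ : ℝ) : ℂ) • (nAt 0 hz σ - ((ν : ℝ) : ℂ) • (1 : FermionOp Λ')) -
        ((κ : ℝ) : ℂ) • (((u : ℝ) : ℂ) • (1 : FermionOp Λ') -
          fermionEmbed (PolySite.incl h0) ((hubbardTTPrimeFermionInteraction t t' U).meanEnergyObs 1)) =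
        (Xw - (c : ℂ) • (1 : FermionOp Λ') -
        ∑ σ : Fin 2, ((μ σ : ℝ) : ℂ) • (nAt 0 hz σ - ((ν : ℝ) : ℂ) • (1 : FermionOp Λ')) -
        ((κ : ℝ) : ℂ) • (((u : ℝ) : ℂ) • (1 : FermionOp Λ') -
          fermionEmbed (PolySite.incl h0) ((hubbardTTPrimeFermionInteraction t t' U).meanEnergyObs 1))) - E := by
      abel
    rw [e1, hcert]
    abel
  have hmain := re_orbitState_ge_of_window_variational_certificate_d4_TT'_ineq t t' U hL hΛ h0 hz hInj' h1 hmul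
    hζ1 (Xw - E) κ u μ ν hΛm O tt γ hγS wv hsh Y ah dc V w a word hcert'
  -- `Γ_L (X − E) = Γ_L X − [H_L, Γ_L Γ(incl) B]`
  have hE' : fermionEmbed (PolySite.toTorusEmb L hInj') E =
      hubbardTorusTT' L t t' U * fermionEmbed (PolySite.toTorusEmb L hInj') (fermionEmbed (PolySite.incl hΛ) B) -
        fermionEmbed (PolySite.toTorusEmb L hInj') (fermionEmbed (PolySite.incl hΛ) B) * hubbardTorusTT' L t t' U := by
    rw [hE]
    exact (hubbardTorusTT'_commutator_fermionEmbed (L := L) (t := t) (t' := t') (U := U) hΛ h8 hInjT B).symm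
  rw [fermionEmbed_sub, map_sub, Complex.sub_re, hE'] at hmain
  linarith

end Window

/-! ### §3  OP1-S certificate ⇒ the summit-format leaf -/

section Leaf

/-- **One OP1-S one-point certificate ⇒ the `t′`-generic summit-format leaf at the SHARP constant.** As
`M3ObsPairLROCeilingAt_of_onePoint_variational_certificate_sq` (OP1-E: `X = −Γ(incl) Φ₀`, cap node
`M3EnergyUpperRow tp hi`, `hi ≤ u`, `κ ≥ 0`, point group `S ∋ 1` closed under multiplication with `b1gSign = 1`, the
identity with SOS + affine-`D₄` defects + filling rows + one energy row + anti-Hermitian parts + residual words) PLUS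
one number-conserving equation-of-motion block `H^{1,tp}_{Λ'} Γ(incl) B − Γ(incl) B H^{1,tp}_{Λ'}` (`B ∈ 𝔄_Λ` with
`[N̂_Λ, B] = 0`, `thicken Λ 1 ⊆ Λ'`). Conclusion: `M3ObsPairLROCeilingAt tp c` for every rational
`c ≥ (c₀ − Σ‖a_k‖ + (Σ_σ μ_σ)(7/16 − ν))²`. [cite: KomaTasaki1994, Theorem 5] [cite: Han2020Bootstrap, §2–3]
[cite: PuszWoronowicz1978, §1] -/
theorem M3ObsPairLROCeilingAt_of_onePoint_stationary_certificate_sq {tp : ℝ} {hi c : ℚ}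
    (hE : M3EnergyUpperRow tp hi) {κ u : ℝ} (hκ : 0 ≤ κ) (hhi : ((hi : ℚ) : ℝ) ≤ u)
    {Λ Λ' : Finset (Site 2)} (hΛ : Λ ⊆ Λ') (h8 : thicken Λ 1 ⊆ Λ')
    (h0 : thicken ({0} : Finset (Site 2)) 1 ⊆ Λ') (hz : (0 : Site 2) ∈ Λ')
    (hP : pairRegion (insert (0 : Site 2) unitSteps) 0 ⊆ Λ')
    {S : Finset (DihedralGroup 4)} (h1 : (1 : DihedralGroup 4) ∈ S) (hmul : ∀ a ∈ S, ∀ b ∈ S, a * b ∈ S)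
    (hS1 : ∀ γ ∈ S, b1gSign γ = 1)
    (μ : Fin 2 → ℝ) (ν : ℝ)
    {m : Type*} [Fintype m] [DecidableEq m] {Λm : Matrix m m ℂ} (hΛm : Λm.PosSemidef)
    (O : m → FermionOp Λ') (B : FermionOp Λ) (hBN : Commute totalNumberOp B)
    {ι : Type*} (tt : Finset ι) (γ : ι → DihedralGroup 4) (hγS : ∀ l ∈ tt, γ l ∈ S) (wv : ι → Site 2)
    (hsh : ∀ l, d4ShiftSet (γ l) (wv l) Λ ⊆ Λ') (Y : ι → FermionOp Λ)
    {δ : Type*} (ah : Finset δ) (dc : δ → ℝ) (V : δ → FermionOp Λ')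
    {κ'' : Type*} (w : Finset κ'') (a : κ'' → ℂ) (word : κ'' → List (Orb (PolySite Λ') × Bool)) {c₀ : ℝ}
    (hcert : -(fermionEmbed (PolySite.incl hP) (localPairAt (insert (0 : Site 2) unitSteps) dWaveFormFactor 0)) -
        (c₀ : ℂ) • (1 : FermionOp Λ') -
        ∑ σ : Fin 2, ((μ σ : ℝ) : ℂ) • (nAt 0 hz σ - ((ν : ℝ) : ℂ) • (1 : FermionOp Λ')) -
        ((κ : ℝ) : ℂ) • (((u : ℝ) : ℂ) • (1 : FermionOp Λ') -
          fermionEmbed (PolySite.incl h0) ((hubbardTTPrimeFermionInteraction 1 tp 8).meanEnergyObs 1)) =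
      gramForm Λm O +
        ((hubbardTTPrimeFermionInteraction 1 tp 8).localHamiltonian Λ' * fermionEmbed (PolySite.incl hΛ) B -
          fermionEmbed (PolySite.incl hΛ) B * (hubbardTTPrimeFermionInteraction 1 tp 8).localHamiltonian Λ') +
        ∑ l ∈ tt, (fermionEmbed (PolySite.incl (hsh l)) (fermionEmbed (PolySite.d4Emb (γ l) (wv l) Λ) (Y l)) -
            fermionEmbed (PolySite.incl hΛ) (Y l)) +
        (∑ m' ∈ ah, ((dc m' : ℝ) : ℂ) • ((V m')ᴴ - V m') + ∑ k ∈ w, a k • ladderWord (word k)))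
    (hc : (c₀ - ∑ k ∈ w, ‖a k‖ + (∑ σ : Fin 2, μ σ) * ((7 / 8 : ℝ) / 2 - ν)) ^ 2 ≤ ((c : ℚ) : ℝ)) :
    M3ObsPairLROCeilingAt tp c := by
  -- sides from which both `Λ'` and `thicken Λ' 1` fit into the torus
  obtain ⟨L₀, hL₀⟩ := exists_forall_le_injOn_proj (d := 2) (thicken Λ' 1)
  have hInjT : ∀ L : ℕ, max L₀ 3 ≤ L → Set.InjOn (Torus.proj (d := 2) L) ↑(thicken Λ' 1) :=
    fun L hL => hL₀ L (le_trans (le_max_left _ _) hL)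
  have hInj : ∀ L : ℕ, max L₀ 3 ≤ L → Set.InjOn (Torus.proj (d := 2) L) ↑Λ' :=
    fun L hL => (hInjT L hL).mono (by exact_mod_cast subset_thicken Λ' 1)
  have hXN : Commute totalNumberOp (fermionEmbed (PolySite.incl hΛ) B) := commute_totalNumberOp_fermionEmbed _ hBN
  refine M3ObsPairLROCeilingAt_of_onePoint_stationary_orbitState_bound_sq (A := ∑ k ∈ w, ‖a k‖) μ hκ hE hhi
    ⟨1, h1⟩ hS1 hP (fermionEmbed (PolySite.incl hΛ) B) hXN (max L₀ 3) hInj ?_ hc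
  intro L _ hL ζ hζ
  have hL3 : 3 ≤ L := le_trans (le_max_right _ _) hL
  exact re_orbitState_ge_of_window_stationary_certificate_d4_TT'_ineq 1 tp 8 hL3 hΛ h8 h0 hz (hInjT L hL) (hInj L hL)
    h1 hmul hζ (-(fermionEmbed (PolySite.incl hP) (localPairAt (insert (0 : Site 2) unitSteps) dWaveFormFactor 0)))
    κ u μ ν hΛm O B tt γ hγS wv hsh Y ah dc V w a word hcert

end Leaf

end Summit.Ventures.CertifiedManyBodySolver.Observables

end
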